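import Summits.NavierStokesRegularity.FluidComputer.PalasekTowerRegisterGlobalCoreFloors
import Summits.NavierStokesRegularity.FluidComputer.PalasekTowerRegisterGlobalHalvesAt

/-!
# REGISTER v2.3′: the lower half AT level `k` read through its Kelvin-critical conjunct

Cell `ns-blowup`, seat `ns-blowup-ecbridge-5` (g3); the level-wise twin of
`PalasekTowerRegisterGlobalCoreFloors.lean` (p430943: the core conjunct of `ReadoutFloors` carries the
velocity / strain conjuncts up to `8π` and the ball slack `1/N_{k+1}`; the ceiling caps the core's
circulation) over `PalasekTowerRegisterGlobalHalvesAt.lean` (p422702: `ReadoutFloorsAt k`, the lower half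
of the hand-over `k → k+1`, with `HeredityAt.readoutFloorsAt` for EVERY `k`, W14-free). LABEL: E–C typing
(KERNEL corollaries, every statement proved). WHAT THIS IS NOT: not Navier–Stokes evidence — no stage,
flow or tower is constructed or asserted; nothing below bears on whether the open halves hold.

* `ReadoutFloorsAt.weak_floors_of_core`: at ANY level `k`, the core conjunct of `ReadoutFloorsAt k` alone
  yields, for every finite-energy classical continuation of a registered stage inside the next ceiling, a
  point within `radius + 1/N_{k+1}` of speed `≥ c₁ Y_{k+1} / (8π)` and one of strain `≥ c₁ A_{k+1} / (8π)`
  at `τ (k+1)`;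
* `HeredityAt.weak_floors`, `HeredityAtOne.weak_floors` (the first rung, item
  stmt-NavierStokesRegularity-19249, `k = 1`: speed `≥ Y₂ / (8π)`, strain `≥ A₂ / (8π)` within
  `radius + 1/N₂` at `τ₂`);
* `HeredityAt.core_circulation_band_rigid`: under heredity at level `k` every registered stage extends to one
  whose level-`(k+1)` core carries circulation in `[N_{k+1}^{3/10}, (40π/3) N_{k+1}^{3/10}]`;
  `HeredityAtOne.core_circulation_band_rigid` (`k = 1`);
* refutation templates at a fixed level: `not_heredityAt_of_slow_readout` /
  `not_heredityAt_of_unstrained_readout` — ONE registered stage at level `k` with ONE finite-energy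
  classical continuation inside the next ceiling whose speed (resp. strain) at `τ (k+1)` stays below the
  weak floor throughout the ball of radius `radius + 1/N_{k+1}` refutes `HeredityAt k` (no loop search);
  at `k = 1` these are templates against the first rung (`not_heredityAtOne_of_slow_readout`,
  `not_heredityAtOne_of_unstrained_readout`).

References: S. Palasek, arXiv:2605.13827 §3.1, §4 [cite: Palasek2026ElementaryModel, §3–§4];
A. J. Majda, A. L. Bertozzi, *Vorticity and Incompressible Flow*, CUP 2002, §1.6 eq. (1.57)
[cite: MajdaBertozziCUP2002, §1.6].
-/

noncomputable section

namespace Summit.NavierStokesRegularity.FluidComputer.PalasekTowerClayBridge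

open Set MeasureTheory Filter Topology Function Real
open scoped ENNReal ContDiff NNReal
open Literature.Analysis.FluidPDE

section AtLevel

variable {k : ℕ}

/-- **The lower half at level `k` is its core conjunct up to `8π` (kernel form)**: `ReadoutFloorsAt k`
implies — through `readout_core_floors`, by its CORE conjunct alone — that every finite-energy classical
continuation of a v2.3′ stage at level `k` inside the next ceiling shows, at `τ (k+1)` and within
`radius + 1/N_{k+1}`, speed `≥ c₁ Y_{k+1} / (8π)` and strain `≥ c₁ A_{k+1} / (8π)`.
[cite: Palasek2026ElementaryModel, §3.1] -/
theorem ReadoutFloorsAt.weak_floors_of_core (h : ReadoutFloorsAt k) :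
    ∀ S : Schedule TowerRates.wide, S.Pins 8 (6 / 5) → S.Rigid → S.Quiet →
    ∀ s : Stage 1 TowerRates.wide S (Margins.routeG TowerRates.wide) k,
    ∀ (u : ℝ → EuclideanSpace ℝ (Fin 3) → EuclideanSpace ℝ (Fin 3))
      (p : ℝ → EuclideanSpace ℝ (Fin 3) → ℝ),
      IsClassicalNSSolutionOn (Icc 0 (S.τ (k + 1))) 1 S.f u p →
      (∀ t ∈ Icc 0 (S.τ k), u t = s.u t ∧ p t = s.p t) →
      (∃ C : ℝ≥0∞, C < ⊤ ∧ ∀ t ∈ Icc 0 (S.τ (k + 1)), ∫⁻ x, ‖u t x‖ₑ ^ 2 ≤ C) →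
      (∀ t ∈ Icc 0 (S.τ (k + 1)), ∀ x, ‖u t x‖ ≤ S.c₂ * TowerRates.wide.Y (k + 1)) →
      (∃ y, ‖y‖ ≤ S.radius + 1 / TowerRates.wide.N (k + 1) ∧
        S.c₁ * TowerRates.wide.Y (k + 1) / (8 * π) ≤ ‖u (S.τ (k + 1)) y‖) ∧
      (∃ y, ‖y‖ ≤ S.radius + 1 / TowerRates.wide.N (k + 1) ∧
        S.c₁ * TowerRates.wide.A (k + 1) / (8 * π) ≤ ‖fderiv ℝ (u (S.τ (k + 1))) y‖) := by
  intro S hP hR hQ s u p hcl hagree hE hceil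
  obtain ⟨-, -, hcore⟩ := h S hP hR hQ s u p hcl hagree hE hceil
  exact readout_core_floors hcl hcore

/-- **Weak floors under heredity at level `k`** (any `k`; W14-free through
`HeredityAt.readoutFloorsAt`). [cite: Palasek2026ElementaryModel, §4] -/
theorem HeredityAt.weak_floors (h : HeredityAt k) :
    ∀ S : Schedule TowerRates.wide, S.Pins 8 (6 / 5) → S.Rigid → S.Quiet →
    ∀ s : Stage 1 TowerRates.wide S (Margins.routeG TowerRates.wide) k,
    ∀ (u : ℝ → EuclideanSpace ℝ (Fin 3) → EuclideanSpace ℝ (Fin 3))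
      (p : ℝ → EuclideanSpace ℝ (Fin 3) → ℝ),
      IsClassicalNSSolutionOn (Icc 0 (S.τ (k + 1))) 1 S.f u p →
      (∀ t ∈ Icc 0 (S.τ k), u t = s.u t ∧ p t = s.p t) →
      (∃ C : ℝ≥0∞, C < ⊤ ∧ ∀ t ∈ Icc 0 (S.τ (k + 1)), ∫⁻ x, ‖u t x‖ₑ ^ 2 ≤ C) →
      (∀ t ∈ Icc 0 (S.τ (k + 1)), ∀ x, ‖u t x‖ ≤ S.c₂ * TowerRates.wide.Y (k + 1)) →
      (∃ y, ‖y‖ ≤ S.radius + 1 / TowerRates.wide.N (k + 1) ∧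
        S.c₁ * TowerRates.wide.Y (k + 1) / (8 * π) ≤ ‖u (S.τ (k + 1)) y‖) ∧
      (∃ y, ‖y‖ ≤ S.radius + 1 / TowerRates.wide.N (k + 1) ∧
        S.c₁ * TowerRates.wide.A (k + 1) / (8 * π) ≤ ‖fderiv ℝ (u (S.τ (k + 1))) y‖) :=
  h.readoutFloorsAt.weak_floors_of_core

/-- **The circulation band of the hand-over under heredity at level `k`** (rigid wide schedules, any `k`):
every registered stage extends to one whose recorded level-`(k+1)` core carries circulation in
`[N_{k+1}^{3/10}, (40π/3) N_{k+1}^{3/10}]`. [cite: Palasek2026ElementaryModel, §3.1] -/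
theorem HeredityAt.core_circulation_band_rigid (h : HeredityAt k) :
    ∀ S : Schedule TowerRates.wide, S.Pins 8 (6 / 5) → S.Rigid → S.Quiet →
    ∀ s : Stage 1 TowerRates.wide S (Margins.routeG TowerRates.wide) k,
    ∃ s' : Stage 1 TowerRates.wide S (Margins.routeG TowerRates.wide) (k + 1), s.Extends s' ∧
      ∃ (x : EuclideanSpace ℝ (Fin 3)) (γ : ℝ → EuclideanSpace ℝ (Fin 3)),
        ‖x‖ ≤ S.radius ∧ ContDiff ℝ 1 γ ∧ γ 0 = γ 1 ∧
        (∀ σ ∈ Icc (0 : ℝ) 1, γ σ ∈ Metric.closedBall x (1 / TowerRates.wide.N (k + 1))) ∧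
        (∀ σ ∈ Icc (0 : ℝ) 1, ‖deriv γ σ‖ ≤ 8 * π / TowerRates.wide.N (k + 1)) ∧
        TowerRates.wide.N (k + 1) ^ (3 / 10 : ℝ) ≤ circulation (s'.u (S.τ (k + 1))) γ ∧
        circulation (s'.u (S.τ (k + 1))) γ ≤ 40 * π / 3 * TowerRates.wide.N (k + 1) ^ (3 / 10 : ℝ) := by
  intro S hP hR hQ s
  obtain ⟨s', hs'⟩ := h S hP hR hQ s
  exact ⟨s', hs', s'.routeG_core_circulation_band_rigid le_rfl⟩

/-- **Refutation template at level `k` (speed).** ONE pinned, rigid, quiet wide schedule with ONE globally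
anchored registered stage at level `k` and ONE finite-energy classical continuation to `τ (k+1)` inside the
next ceiling whose speed at `τ (k+1)` stays below `c₁ Y_{k+1} / (8π)` throughout the ball of radius
`radius + 1/N_{k+1}` refutes `HeredityAt k` (typed witness hypothesis; none asserted).
[cite: Palasek2026ElementaryModel, §3.1] -/
theorem not_heredityAt_of_slow_readout
    (hW : ∃ (S : Schedule TowerRates.wide)
      (s : Stage 1 TowerRates.wide S (Margins.routeG TowerRates.wide) k)
      (u : ℝ → EuclideanSpace ℝ (Fin 3) → EuclideanSpace ℝ (Fin 3))
      (p : ℝ → EuclideanSpace ℝ (Fin 3) → ℝ),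
      S.Pins 8 (6 / 5) ∧ S.Rigid ∧ S.Quiet ∧
      IsClassicalNSSolutionOn (Icc 0 (S.τ (k + 1))) 1 S.f u p ∧
      (∀ t ∈ Icc 0 (S.τ k), u t = s.u t ∧ p t = s.p t) ∧
      (∃ C : ℝ≥0∞, C < ⊤ ∧ ∀ t ∈ Icc 0 (S.τ (k + 1)), ∫⁻ x, ‖u t x‖ₑ ^ 2 ≤ C) ∧
      (∀ t ∈ Icc 0 (S.τ (k + 1)), ∀ x, ‖u t x‖ ≤ S.c₂ * TowerRates.wide.Y (k + 1)) ∧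
      (∀ y, ‖y‖ ≤ S.radius + 1 / TowerRates.wide.N (k + 1) →
        ‖u (S.τ (k + 1)) y‖ < S.c₁ * TowerRates.wide.Y (k + 1) / (8 * π))) :
    ¬ HeredityAt k := by
  intro h
  obtain ⟨S, s, u, p, hP, hR, hQ, hcl, hagree, hE, hceil, hslow⟩ := hW
  obtain ⟨⟨y, hy, hge⟩, -⟩ := h.weak_floors S hP hR hQ s u p hcl hagree hE hceil
  exact absurd hge (not_le.2 (hslow y hy))

/-- **Refutation template at level `k` (strain).** The same with the velocity gradient: a continuation whose
strain at `τ (k+1)` stays below `c₁ A_{k+1} / (8π)` throughout the ball of radius `radius + 1/N_{k+1}`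
refutes `HeredityAt k`. [cite: Palasek2026ElementaryModel, §3.1] -/
theorem not_heredityAt_of_unstrained_readout
    (hW : ∃ (S : Schedule TowerRates.wide)
      (s : Stage 1 TowerRates.wide S (Margins.routeG TowerRates.wide) k)
      (u : ℝ → EuclideanSpace ℝ (Fin 3) → EuclideanSpace ℝ (Fin 3))
      (p : ℝ → EuclideanSpace ℝ (Fin 3) → ℝ),
      S.Pins 8 (6 / 5) ∧ S.Rigid ∧ S.Quiet ∧
      IsClassicalNSSolutionOn (Icc 0 (S.τ (k + 1))) 1 S.f u p ∧
      (∀ t ∈ Icc 0 (S.τ k), u t = s.u t ∧ p t = s.p t) ∧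
      (∃ C : ℝ≥0∞, C < ⊤ ∧ ∀ t ∈ Icc 0 (S.τ (k + 1)), ∫⁻ x, ‖u t x‖ₑ ^ 2 ≤ C) ∧
      (∀ t ∈ Icc 0 (S.τ (k + 1)), ∀ x, ‖u t x‖ ≤ S.c₂ * TowerRates.wide.Y (k + 1)) ∧
      (∀ y, ‖y‖ ≤ S.radius + 1 / TowerRates.wide.N (k + 1) →
        ‖fderiv ℝ (u (S.τ (k + 1))) y‖ < S.c₁ * TowerRates.wide.A (k + 1) / (8 * π))) :
    ¬ HeredityAt k := by
  intro h
  obtain ⟨S, s, u, p, hP, hR, hQ, hcl, hagree, hE, hceil, hflat⟩ := hW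
  obtain ⟨-, ⟨y, hy, hge⟩⟩ := h.weak_floors S hP hR hQ s u p hcl hagree hE hceil
  exact absurd hge (not_le.2 (hflat y hy))

end AtLevel

/-! ## The first rung `k = 1` (item stmt-NavierStokesRegularity-19249) -/

/-- **Weak floors under the first rung**: `HeredityAtOne` forces, on every finite-energy classical
continuation of a registered level-1 stage inside the ceiling `(5/3) Y₂`, a point within `radius + 1/N₂`
of speed `≥ Y₂ / (8π)` (`c₁ = 1`) and one of strain `≥ A₂ / (8π)` at `τ₂`. [cite: Palasek2026ElementaryModel, §4] -/
theorem HeredityAtOne.weak_floors (h : HeredityAtOne) :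
    ∀ S : Schedule TowerRates.wide, S.Pins 8 (6 / 5) → S.Rigid → S.Quiet →
    ∀ s : Stage 1 TowerRates.wide S (Margins.routeG TowerRates.wide) 1,
    ∀ (u : ℝ → EuclideanSpace ℝ (Fin 3) → EuclideanSpace ℝ (Fin 3))
      (p : ℝ → EuclideanSpace ℝ (Fin 3) → ℝ),
      IsClassicalNSSolutionOn (Icc 0 (S.τ (1 + 1))) 1 S.f u p →
      (∀ t ∈ Icc 0 (S.τ 1), u t = s.u t ∧ p t = s.p t) →
      (∃ C : ℝ≥0∞, C < ⊤ ∧ ∀ t ∈ Icc 0 (S.τ (1 + 1)), ∫⁻ x, ‖u t x‖ₑ ^ 2 ≤ C) →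
      (∀ t ∈ Icc 0 (S.τ (1 + 1)), ∀ x, ‖u t x‖ ≤ S.c₂ * TowerRates.wide.Y (1 + 1)) →
      (∃ y, ‖y‖ ≤ S.radius + 1 / TowerRates.wide.N (1 + 1) ∧
        S.c₁ * TowerRates.wide.Y (1 + 1) / (8 * π) ≤ ‖u (S.τ (1 + 1)) y‖) ∧
      (∃ y, ‖y‖ ≤ S.radius + 1 / TowerRates.wide.N (1 + 1) ∧
        S.c₁ * TowerRates.wide.A (1 + 1) / (8 * π) ≤ ‖fderiv ℝ (u (S.τ (1 + 1))) y‖) :=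
  HeredityAt.weak_floors (heredityAtOne_iff.1 h)

/-- **The circulation band of the first hand-over** `1 → 2` under `HeredityAtOne`: every registered level-1
stage extends to a level-2 stage whose `N₂`-core carries circulation in `[N₂^{3/10}, (40π/3) N₂^{3/10}]`.
[cite: Palasek2026ElementaryModel, §3.1] -/
theorem HeredityAtOne.core_circulation_band_rigid (h : HeredityAtOne) :
    ∀ S : Schedule TowerRates.wide, S.Pins 8 (6 / 5) → S.Rigid → S.Quiet →
    ∀ s : Stage 1 TowerRates.wide S (Margins.routeG TowerRates.wide) 1,
    ∃ s' : Stage 1 TowerRates.wide S (Margins.routeG TowerRates.wide) (1 + 1), s.Extends s' ∧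
      ∃ (x : EuclideanSpace ℝ (Fin 3)) (γ : ℝ → EuclideanSpace ℝ (Fin 3)),
        ‖x‖ ≤ S.radius ∧ ContDiff ℝ 1 γ ∧ γ 0 = γ 1 ∧
        (∀ σ ∈ Icc (0 : ℝ) 1, γ σ ∈ Metric.closedBall x (1 / TowerRates.wide.N (1 + 1))) ∧
        (∀ σ ∈ Icc (0 : ℝ) 1, ‖deriv γ σ‖ ≤ 8 * π / TowerRates.wide.N (1 + 1)) ∧
        TowerRates.wide.N (1 + 1) ^ (3 / 10 : ℝ) ≤ circulation (s'.u (S.τ (1 + 1))) γ ∧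
        circulation (s'.u (S.τ (1 + 1))) γ ≤ 40 * π / 3 * TowerRates.wide.N (1 + 1) ^ (3 / 10 : ℝ) :=
  HeredityAt.core_circulation_band_rigid (heredityAtOne_iff.1 h)

/-- **Refutation template against the first rung (speed)**: ONE registered level-1 stage of a pinned rigid
quiet wide schedule with ONE finite-energy classical continuation to `τ₂` inside `(5/3) Y₂` whose speed
at `τ₂` stays below `Y₂ / (8π)` throughout the ball of radius `radius + 1/N₂` refutes `HeredityAtOne`.
[cite: Palasek2026ElementaryModel, §3.1] -/
theorem not_heredityAtOne_of_slow_readout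
    (hW : ∃ (S : Schedule TowerRates.wide)
      (s : Stage 1 TowerRates.wide S (Margins.routeG TowerRates.wide) 1)
      (u : ℝ → EuclideanSpace ℝ (Fin 3) → EuclideanSpace ℝ (Fin 3))
      (p : ℝ → EuclideanSpace ℝ (Fin 3) → ℝ),
      S.Pins 8 (6 / 5) ∧ S.Rigid ∧ S.Quiet ∧
      IsClassicalNSSolutionOn (Icc 0 (S.τ (1 + 1))) 1 S.f u p ∧
      (∀ t ∈ Icc 0 (S.τ 1), u t = s.u t ∧ p t = s.p t) ∧
      (∃ C : ℝ≥0∞, C < ⊤ ∧ ∀ t ∈ Icc 0 (S.τ (1 + 1)), ∫⁻ x, ‖u t x‖ₑ ^ 2 ≤ C) ∧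
      (∀ t ∈ Icc 0 (S.τ (1 + 1)), ∀ x, ‖u t x‖ ≤ S.c₂ * TowerRates.wide.Y (1 + 1)) ∧
      (∀ y, ‖y‖ ≤ S.radius + 1 / TowerRates.wide.N (1 + 1) →
        ‖u (S.τ (1 + 1)) y‖ < S.c₁ * TowerRates.wide.Y (1 + 1) / (8 * π))) :
    ¬ HeredityAtOne := fun h =>
  not_heredityAt_of_slow_readout hW (heredityAtOne_iff.1 h)

/-- **Refutation template against the first rung (strain)**: the same with the velocity gradient at `τ₂`
below `A₂ / (8π)` throughout the ball of radius `radius + 1/N₂`. [cite: Palasek2026ElementaryModel, §3.1] -/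
theorem not_heredityAtOne_of_unstrained_readout
    (hW : ∃ (S : Schedule TowerRates.wide)
      (s : Stage 1 TowerRates.wide S (Margins.routeG TowerRates.wide) 1)
      (u : ℝ → EuclideanSpace ℝ (Fin 3) → EuclideanSpace ℝ (Fin 3))
      (p : ℝ → EuclideanSpace ℝ (Fin 3) → ℝ),
      S.Pins 8 (6 / 5) ∧ S.Rigid ∧ S.Quiet ∧
      IsClassicalNSSolutionOn (Icc 0 (S.τ (1 + 1))) 1 S.f u p ∧
      (∀ t ∈ Icc 0 (S.τ 1), u t = s.u t ∧ p t = s.p t) ∧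
      (∃ C : ℝ≥0∞, C < ⊤ ∧ ∀ t ∈ Icc 0 (S.τ (1 + 1)), ∫⁻ x, ‖u t x‖ₑ ^ 2 ≤ C) ∧
      (∀ t ∈ Icc 0 (S.τ (1 + 1)), ∀ x, ‖u t x‖ ≤ S.c₂ * TowerRates.wide.Y (1 + 1)) ∧
      (∀ y, ‖y‖ ≤ S.radius + 1 / TowerRates.wide.N (1 + 1) →
        ‖fderiv ℝ (u (S.τ (1 + 1))) y‖ < S.c₁ * TowerRates.wide.A (1 + 1) / (8 * π))) :
    ¬ HeredityAtOne := fun h =>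
  not_heredityAt_of_unstrained_readout hW (heredityAtOne_iff.1 h)

end Summit.NavierStokesRegularity.FluidComputer.PalasekTowerClayBridge

end
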